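import Literature.NumberTheory.LFunctions.KloostermanIncompleteSplit
import Literature.NumberTheory.Sieve.DrappeauDispersionLemmas
import HarnessLib

/-!
# Kloosterman-fraction phases of a Linnik dispersion: congruence structure and the pair sum

Topic `NumberTheory/LFunctions` (exponential sums; the arithmetic half of Linnik's dispersion
method for a bilinear form in the divisibility conditions `u ∣ A d m + B`, after E. Bombieri,
J. B. Friedlander, H. Iwaniec, *Primes in arithmetic progressions to large moduli*, Acta Math. 156
(1986), §6 and §9, with Weil's bound for incomplete Kloosterman sums in place of the
Deshouillers–Iwaniec estimates).  Written for the dispersion range of the linear pair window of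
the polynomial Möbius tail (crux `PolyMobiusTail`, summit Parity/BatemanHorn), but nothing here
refers to it: `A, B, Q, u, u', m, m'` are arbitrary.  Everything is PROVED; there are no
definitions and no named facts.  Continued in `DispersionFourierDecay` (the analytic half),
`Sieve/LinearDispersionPoisson` and `Sieve/LinearDispersionEngine`.

## Contents

* Chinese-remainder bookkeeping: `DK_exists_residue_two`, `DK_exists_residue_three` (one class
  modulo `ab`, `abc` from classes modulo pairwise coprime `a, b, c`), `DK_stdAddChar_split_three`
  (`e(t/(abc)) = e(t (bc)‾/a) e(t (ac)‾/b) e(t (ab)‾/c)`), and small conversions between the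
  phases `e(a x̄/s)`, Mathlib's `ZMod.stdAddChar` and the Fourier character `𝐞`
  (`DK_dvd_iff_eq_residue`, `DK_gcd_eq_one_of_dvd`,
  `DK_fourierChar_eq_stdAddChar`, `DK_stdAddChar_eq_exp_val`,
  `DK_gcd_facts`, `DK_int_gcd_eq_one_of_dvd`; the phase `e(a x̄/s) = ψ_s(a x⁻¹)` is
  `Sieve.Iwaniec1978.hooley_term_eq_stdAddChar` of `Sieve/IwaniecAlmostPrimesHooley`).
* `DK_cond_of_dvd` — `u ∣ A d m + B`, `u' ∣ A d m' + B`, `(B, uu') = 1` force `(m, u) = (m', u') = 1`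
  and `m ≡ m' (mod (u, u'))` (BFI (6.1)).
* **`DK_congr_structure`** — for squarefree `u, u'` coprime to `A Q` and to `B` and a compatible
  pair `m, m'`, the `d ≡ c_d (mod Q)` with `u ∣ A d m + B`, `u' ∣ A d m' + B` form one class `r`
  modulo `N = Q u v` (`v = u'/(u,u')`), and `e(r h/N)` factors as
  `e(c_d h (uv)‾/Q) · e(−hB (AQv m)‾/u) · e(−hB (AQu m')‾/v)` (BFI (6.10)).
* `DK_sum_pairs_modEq_eq` (splitting a sum over pairs `y ≡ y' (mod e)` into the `e` classes),
  `DK_classSum_left_le`, `DK_classSum_right_le` (each class sum is an incomplete Kloosterman sum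
  in a progression, bounded through the tree's `KI_sum_subprogression_le`, i.e. Weil's bound with
  the Bettin–Chandee bookkeeping), and **`DK_pairSum_le`** — the sum of the factored phases over
  the compatible pairs `(y, y')`, `m = c_m + Qy`, is
  `≤ e (h, u₁v) (((y₂−y₁)/e+2)/u₁ + τ(u₁)√u₁(1+log u₁)) (((y₂−y₁)/e+2)/v + τ(v)√v(1+log v))`
  (BFI §9 (9.1)–(9.3) in this setting).

## References

* E. Bombieri, J. B. Friedlander, H. Iwaniec, Acta Math. 156 (1986), 203–251, §6, §9.
  [BombieriFriedlanderIwaniecActa1986]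
* S. Bettin, V. Chandee, Adv. Math. 328 (2018), Appendix, Lemma 1. [BettinChandee2018]
-/

noncomputable section

open Finset
open scoped FourierTransform

namespace Literature.NumberTheory.LFunctions

open Literature.NumberTheory.Sieve.Iwaniec1978 (hooley_term_eq_stdAddChar
  hooley_gcd_eq_one_iff_isUnit)

/-- **One class from two** (Chinese remainder theorem): for coprime `a, b ≥ 1` and classes
`r_a (mod a)`, `r_b (mod b)` there is a class `r (mod ab)` with
`d ≡ r_a (a) ∧ d ≡ r_b (b) ↔ d ≡ r (ab)` for every integer `d`. [folklore] -/
theorem DK_exists_residue_two {a b : ℕ} (ha : 0 < a) (hb : 0 < b) (hab : a.Coprime b)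
    (ra : ZMod a) (rb : ZMod b) :
    ∃ r : ZMod (a * b), ∀ d : ℤ,
      ((d : ZMod a) = ra ∧ (d : ZMod b) = rb) ↔ (d : ZMod (a * b)) = r := by
  haveI : NeZero a := ⟨ha.ne'⟩
  haveI : NeZero b := ⟨hb.ne'⟩
  obtain ⟨k, hka, hkb⟩ := Nat.chineseRemainder (n := a) (m := b) hab ra.val rb.val
  refine ⟨((k : ℤ) : ZMod (a * b)), fun d => ?_⟩
  have hka' : ((k : ℤ) : ZMod a) = ra := by
    rw [Int.cast_natCast, (ZMod.natCast_eq_natCast_iff _ _ _).2 hka, ZMod.natCast_zmod_val]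
  have hkb' : ((k : ℤ) : ZMod b) = rb := by
    rw [Int.cast_natCast, (ZMod.natCast_eq_natCast_iff _ _ _).2 hkb, ZMod.natCast_zmod_val]
  rw [← hka', ← hkb', ZMod.intCast_eq_intCast_iff, ZMod.intCast_eq_intCast_iff,
    ZMod.intCast_eq_intCast_iff]
  push_cast
  exact Int.modEq_and_modEq_iff_modEq_mul (by simpa using hab)

/-- **One class from three**: for pairwise coprime `a, b, c ≥ 1` and classes modulo `a`, `b`, `c`
there is a class `r (mod abc)` with `d ≡ r_a (a) ∧ d ≡ r_b (b) ∧ d ≡ r_c (c) ↔ d ≡ r (abc)` for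
every integer `d`. [folklore] -/
theorem DK_exists_residue_three {a b c : ℕ} (ha : 0 < a) (hb : 0 < b) (hc : 0 < c)
    (hab : a.Coprime b) (hac : a.Coprime c) (hbc : b.Coprime c)
    (ra : ZMod a) (rb : ZMod b) (rc : ZMod c) :
    ∃ r : ZMod (a * b * c), ∀ d : ℤ,
      ((d : ZMod a) = ra ∧ (d : ZMod b) = rb ∧ (d : ZMod c) = rc) ↔ (d : ZMod (a * b * c)) = r := by
  obtain ⟨rab, hrab⟩ := DK_exists_residue_two ha hb hab ra rb
  obtain ⟨r, hr⟩ := DK_exists_residue_two (Nat.mul_pos ha hb) hc (Nat.Coprime.mul_left hac hbc) rab rc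
  refine ⟨r, fun d => ?_⟩
  rw [← hr d, ← hrab d, and_assoc]

/-- **Splitting an additive character modulo `abc`** (Chinese remainder theorem): for pairwise
coprime `a, b, c ≥ 1` and an integer `t`,
`e(t/(abc)) = e(t (bc)‾/a) · e(t (ac)‾/b) · e(t (ab)‾/c)`, the bars denoting inverses modulo
`a`, `b`, `c` respectively (since `bc (bc)‾ + ac (ac)‾ + ab (ab)‾ ≡ 1 (mod abc)`). [folklore] -/
theorem DK_stdAddChar_split_three {a b c : ℕ} [NeZero a] [NeZero b] [NeZero c]
    (hab : a.Coprime b) (hac : a.Coprime c) (hbc : b.Coprime c) (t : ℤ) :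
    (ZMod.stdAddChar ((t : ZMod (a * b * c))) : ℂ) =
      ZMod.stdAddChar ((t : ZMod a) * (((b * c : ℕ) : ZMod a))⁻¹) *
        ZMod.stdAddChar ((t : ZMod b) * (((a * c : ℕ) : ZMod b))⁻¹) *
          ZMod.stdAddChar ((t : ZMod c) * (((a * b : ℕ) : ZMod c))⁻¹) := by
  have ha : 0 < a := Nat.pos_of_ne_zero (NeZero.ne a)
  have hb : 0 < b := Nat.pos_of_ne_zero (NeZero.ne b)
  have hc : 0 < c := Nat.pos_of_ne_zero (NeZero.ne c)
  haveI : NeZero (a * b * c) := ⟨(Nat.mul_pos (Nat.mul_pos ha hb) hc).ne'⟩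
  set σa : ℕ := (((b * c : ℕ) : ZMod a)⁻¹).val with hσa
  set σb : ℕ := (((a * c : ℕ) : ZMod b)⁻¹).val with hσb
  set σc : ℕ := (((a * b : ℕ) : ZMod c)⁻¹).val with hσc
  have hua : IsUnit ((b * c : ℕ) : ZMod a) :=
    (ZMod.isUnit_iff_coprime _ _).mpr (Nat.Coprime.mul_left hab.symm hac.symm)
  have hub : IsUnit ((a * c : ℕ) : ZMod b) :=
    (ZMod.isUnit_iff_coprime _ _).mpr (Nat.Coprime.mul_left hab hbc.symm)
  have huc : IsUnit ((a * b : ℕ) : ZMod c) :=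
    (ZMod.isUnit_iff_coprime _ _).mpr (Nat.Coprime.mul_left hac hbc)
  -- `E = bc σa + ac σb + ab σc ≡ 1 (mod abc)`
  have hEa : (b * c * σa + a * c * σb + a * b * σc) ≡ 1 [MOD a] := by
    rw [← ZMod.natCast_eq_natCast_iff]
    push_cast
    simp only [ZMod.natCast_self, zero_mul, add_zero]
    rw [hσa, ZMod.natCast_zmod_val, ← Nat.cast_mul, ZMod.mul_inv_of_unit _ hua]
  have hEb : (b * c * σa + a * c * σb + a * b * σc) ≡ 1 [MOD b] := by
    rw [← ZMod.natCast_eq_natCast_iff]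
    push_cast
    simp only [ZMod.natCast_self, zero_mul, mul_zero, add_zero, zero_add]
    rw [hσb, ZMod.natCast_zmod_val, ← Nat.cast_mul, ZMod.mul_inv_of_unit _ hub]
  have hEc : (b * c * σa + a * c * σb + a * b * σc) ≡ 1 [MOD c] := by
    rw [← ZMod.natCast_eq_natCast_iff]
    push_cast
    simp only [ZMod.natCast_self, zero_mul, mul_zero, zero_add]
    rw [hσc, ZMod.natCast_zmod_val, ← Nat.cast_mul, ZMod.mul_inv_of_unit _ huc]
  have hE : (b * c * σa + a * c * σb + a * b * σc) ≡ 1 [MOD a * b * c] :=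
    (Nat.modEq_and_modEq_iff_modEq_mul (Nat.Coprime.mul_left hac hbc)).mp
      ⟨(Nat.modEq_and_modEq_iff_modEq_mul hab).mp ⟨hEa, hEb⟩, hEc⟩
  -- hence `t = t σa bc + t σb ac + t σc ab` modulo `abc`
  have ht : (t : ZMod (a * b * c)) = ((t * σa * (b * c) : ℤ) : ZMod (a * b * c)) +
      ((t * σb * (a * c) : ℤ) : ZMod (a * b * c)) + ((t * σc * (a * b) : ℤ) : ZMod (a * b * c)) := by
    have h1 : (((b * c * σa + a * c * σb + a * b * σc : ℕ) : ZMod (a * b * c))) = 1 := by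
      rw [(ZMod.natCast_eq_natCast_iff _ _ _).mpr hE, Nat.cast_one]
    push_cast at h1 ⊢
    linear_combination (-(t : ZMod (a * b * c))) * h1
  rw [ht, AddChar.map_add_eq_mul, AddChar.map_add_eq_mul]
  -- each piece is a character to the smaller modulus
  have haC : (a : ℂ) ≠ 0 := by exact_mod_cast ha.ne'
  have hbC : (b : ℂ) ≠ 0 := by exact_mod_cast hb.ne'
  have hcC : (c : ℂ) ≠ 0 := by exact_mod_cast hc.ne'
  have e1 : (ZMod.stdAddChar ((t * σa * (b * c) : ℤ) : ZMod (a * b * c)) : ℂ) =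
      ZMod.stdAddChar ((t : ZMod a) * (((b * c : ℕ) : ZMod a))⁻¹) := by
    have : (t : ZMod a) * (((b * c : ℕ) : ZMod a))⁻¹ = ((t * σa : ℤ) : ZMod a) := by
      rw [hσa]; push_cast; rw [ZMod.natCast_zmod_val]
    rw [this, ZMod.stdAddChar_coe, ZMod.stdAddChar_coe]
    congr 1
    push_cast
    field_simp
  have e2 : (ZMod.stdAddChar ((t * σb * (a * c) : ℤ) : ZMod (a * b * c)) : ℂ) =
      ZMod.stdAddChar ((t : ZMod b) * (((a * c : ℕ) : ZMod b))⁻¹) := by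
    have : (t : ZMod b) * (((a * c : ℕ) : ZMod b))⁻¹ = ((t * σb : ℤ) : ZMod b) := by
      rw [hσb]; push_cast; rw [ZMod.natCast_zmod_val]
    rw [this, ZMod.stdAddChar_coe, ZMod.stdAddChar_coe]
    congr 1
    push_cast
    field_simp
  have e3 : (ZMod.stdAddChar ((t * σc * (a * b) : ℤ) : ZMod (a * b * c)) : ℂ) =
      ZMod.stdAddChar ((t : ZMod c) * (((a * b : ℕ) : ZMod c))⁻¹) := by
    have : (t : ZMod c) * (((a * b : ℕ) : ZMod c))⁻¹ = ((t * σc : ℤ) : ZMod c) := by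
      rw [hσc]; push_cast; rw [ZMod.natCast_zmod_val]
    rw [this, ZMod.stdAddChar_coe, ZMod.stdAddChar_coe]
    congr 1
    push_cast
    field_simp
  rw [e1, e2, e3]


/-! ### Small conversions -/

/-- `s ∣ d x + B ↔ d ≡ −B x̄ (mod s)` for `x` invertible modulo `s`. [folklore] -/
theorem DK_dvd_iff_eq_residue {s : ℕ} [NeZero s] {x : ℤ} (hx : IsUnit (x : ZMod s)) (B d : ℤ) :
    (s : ℤ) ∣ d * x + B ↔ (d : ZMod s) = -(B : ZMod s) * (x : ZMod s)⁻¹ := by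
  rw [← ZMod.intCast_zmod_eq_zero_iff_dvd]
  push_cast
  constructor
  · intro h
    have h1 : (d : ZMod s) * (x : ZMod s) = -(B : ZMod s) := by linear_combination h
    calc (d : ZMod s) = (d : ZMod s) * ((x : ZMod s) * (x : ZMod s)⁻¹) := by
          rw [ZMod.mul_inv_of_unit _ hx, mul_one]
      _ = -(B : ZMod s) * (x : ZMod s)⁻¹ := by rw [← mul_assoc, h1]
  · intro h
    rw [h]
    calc -(B : ZMod s) * (x : ZMod s)⁻¹ * (x : ZMod s) + (B : ZMod s)
        = -(B : ZMod s) * ((x : ZMod s) * (x : ZMod s)⁻¹) + (B : ZMod s) := by ring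
      _ = 0 := by rw [ZMod.mul_inv_of_unit _ hx]; ring

/-- If `s ∣ x k + B` and `(B, s) = 1` then `(x, s) = 1`. [folklore] -/
theorem DK_gcd_eq_one_of_dvd {s : ℕ} {x k B : ℤ} (h : (s : ℤ) ∣ x * k + B) (hB : Int.gcd B s = 1) :
    Int.gcd x s = 1 := by
  have h1 : ((Int.gcd x s : ℕ) : ℤ) ∣ x * k := Dvd.dvd.mul_right (Int.gcd_dvd_left x s) _
  have h2 : ((Int.gcd x s : ℕ) : ℤ) ∣ x * k + B := dvd_trans (Int.gcd_dvd_right x s) h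
  have h3 : ((Int.gcd x s : ℕ) : ℤ) ∣ B := (Int.dvd_add_right h1).mp h2
  have h4 : ((Int.gcd x s : ℕ) : ℤ) ∣ ((Int.gcd B s : ℕ) : ℤ) :=
    Int.dvd_coe_gcd h3 (Int.gcd_dvd_right x s)
  rw [hB] at h4
  have h5 : Int.gcd x s ∣ 1 := by exact_mod_cast h4
  exact Nat.eq_one_of_dvd_one h5

/-- The phase of Poisson summation `e(c h/N)` (with `c` the least residue of a class modulo `N`)
as a value of the standard additive character of `ℤ/Nℤ`. [folklore] -/
theorem DK_fourierChar_eq_stdAddChar {N : ℕ} [NeZero N] (r : ZMod N) (h : ℤ) :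
    ((𝐞 ((r.val : ℝ) * h / N) : Circle) : ℂ) =
      (ZMod.stdAddChar ((((r.val : ℕ) : ℤ) * h : ℤ) : ZMod N) : ℂ) := by
  rw [ZMod.stdAddChar_coe, Real.fourierChar_apply]
  congr 1
  push_cast
  ring

/-- The value of the standard additive character at a class, through its least residue:
`ψ(x) = e(x.val / N)`. [folklore] -/
theorem DK_stdAddChar_eq_exp_val {N : ℕ} [NeZero N] (x : ZMod N) :
    (ZMod.stdAddChar x : ℂ) =
      Complex.exp (2 * Real.pi * Complex.I * (((x.val : ℕ) : ℂ) / (N : ℂ))) := by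
  conv_lhs => rw [← ZMod.natCast_zmod_val x, ← Int.cast_natCast, ZMod.stdAddChar_coe]
  congr 1
  push_cast
  ring

/-! ### The congruence structure of `u ∣ A d m + B`, `u' ∣ A d m' + B`, `d ≡ c_d (mod Q)` -/

/-- **Necessary conditions.**  If `u ∣ A d m + B` and `u' ∣ A d m' + B` with `(B, u) = (B, u') = 1`,
then `(m, u) = 1`, `(m', u') = 1` and `m ≡ m' (mod (u, u'))` (the last because `A d` is a unit
modulo `(u, u')`).  [cite: BombieriFriedlanderIwaniecActa1986, §6 (6.1) p. 219] -/
theorem DK_cond_of_dvd {A B : ℤ} {u u' : ℕ} (hBu : Int.gcd B u = 1) (hBu' : Int.gcd B u' = 1)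
    {d m m' : ℤ} (h₁ : (u : ℤ) ∣ A * d * m + B) (h₂ : (u' : ℤ) ∣ A * d * m' + B) :
    Int.gcd m u = 1 ∧ Int.gcd m' u' = 1 ∧ m ≡ m' [ZMOD (Nat.gcd u u' : ℕ)] := by
  refine ⟨DK_gcd_eq_one_of_dvd (k := A * d) (by rw [show m * (A * d) + B = A * d * m + B by ring]; exact h₁) hBu,
    DK_gcd_eq_one_of_dvd (k := A * d) (by rw [show m' * (A * d) + B = A * d * m' + B by ring]; exact h₂) hBu', ?_⟩
  set e : ℕ := Nat.gcd u u' with he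
  have he₁ : ((e : ℕ) : ℤ) ∣ (u : ℤ) := Int.natCast_dvd_natCast.mpr (Nat.gcd_dvd_left u u')
  have he₂ : ((e : ℕ) : ℤ) ∣ (u' : ℤ) := Int.natCast_dvd_natCast.mpr (Nat.gcd_dvd_right u u')
  have hBe : Int.gcd B e = 1 := by
    rw [← Int.isCoprime_iff_gcd_eq_one] at hBu ⊢
    obtain ⟨w, hw⟩ := he₁
    rw [hw] at hBu
    exact IsCoprime.of_mul_right_left hBu
  have g₁ : (e : ℤ) ∣ A * d * m + B := dvd_trans he₁ h₁
  have g₂ : (e : ℤ) ∣ A * d * m' + B := dvd_trans he₂ h₂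
  -- `A d` is a unit modulo `e`
  have hAd : Int.gcd (A * d) e = 1 :=
    DK_gcd_eq_one_of_dvd (k := m) (by rw [show A * d * m + B = A * d * m + B from rfl]; exact g₁) hBe
  have g₃ : (e : ℤ) ∣ A * d * (m - m') := by
    rw [show A * d * (m - m') = (A * d * m + B) - (A * d * m' + B) by ring]
    exact dvd_sub g₁ g₂
  have g₄ : (e : ℤ) ∣ m - m' :=
    IsCoprime.dvd_of_dvd_mul_left
      (IsCoprime.symm ((Int.isCoprime_iff_gcd_eq_one).mpr hAd)) g₃
  exact (Int.modEq_iff_dvd.mpr g₄).symm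


/-- Elementary facts about `e = (u, u')`, `v = u'/e` for squarefree `u, u'`: `u' = e v`,
`(e, v) = (u, v) = 1`, `e, v ≥ 1`. [folklore] -/
theorem DK_gcd_facts {u u' : ℕ} (hu : Squarefree u) (hu' : Squarefree u') :
    u' = Nat.gcd u u' * (u' / Nat.gcd u u') ∧ (Nat.gcd u u').Coprime (u' / Nat.gcd u u') ∧
      u.Coprime (u' / Nat.gcd u u') ∧ 0 < Nat.gcd u u' ∧ 0 < u' / Nat.gcd u u' ∧
      u = Nat.gcd u u' * (u / Nat.gcd u u') ∧ (Nat.gcd u u').Coprime (u / Nat.gcd u u') := by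
  have hu0 : 0 < u := Nat.pos_of_ne_zero hu.ne_zero
  have hu'0 : 0 < u' := Nat.pos_of_ne_zero hu'.ne_zero
  have he0 : 0 < Nat.gcd u u' := Nat.gcd_pos_of_pos_left _ hu0
  have hu'e : u' = Nat.gcd u u' * (u' / Nat.gcd u u') :=
    (Nat.mul_div_cancel' (Nat.gcd_dvd_right u u')).symm
  have hue : u = Nat.gcd u u' * (u / Nat.gcd u u') :=
    (Nat.mul_div_cancel' (Nat.gcd_dvd_left u u')).symm
  have hev : (Nat.gcd u u').Coprime (u' / Nat.gcd u u') := by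
    have h := hu'
    rw [hu'e] at h
    exact (Nat.squarefree_mul_iff.mp h).1
  have heu : (Nat.gcd u u').Coprime (u / Nat.gcd u u') := by
    have h := hu
    rw [hue] at h
    exact (Nat.squarefree_mul_iff.mp h).1
  have huv : u.Coprime (u' / Nat.gcd u u') := by
    have h1 : (u / Nat.gcd u u').Coprime (u' / Nat.gcd u u') := Nat.coprime_div_gcd_div_gcd he0
    have h2 := Nat.Coprime.mul_left hev h1
    rwa [← hue] at h2
  have hv0 : 0 < u' / Nat.gcd u u' :=
    Nat.div_pos (Nat.le_of_dvd hu'0 (Nat.gcd_dvd_right u u')) he0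
  exact ⟨hu'e, hev, huv, he0, hv0, hue, heu⟩

/-- Coprimality with a divisor: `(B, t) = 1` and `s ∣ t` give `(B, s) = 1` (integer `B`). [folklore] -/
theorem DK_int_gcd_eq_one_of_dvd {B : ℤ} {s t : ℕ} (h : Int.gcd B t = 1) (hst : s ∣ t) :
    Int.gcd B s = 1 := by
  rw [← Int.isCoprime_iff_gcd_eq_one] at h ⊢
  obtain ⟨w, hw⟩ := hst
  rw [hw, Nat.cast_mul] at h
  exact IsCoprime.of_mul_right_left h

/-- **The congruence structure of the dispersion** (BFI §6, (6.1): "the solutions form one class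
modulo `[q₁,q₂]r`").  Let `u, u'` be squarefree and coprime to `A Q` and to `B`, `e = (u, u')`,
`v = u'/e`, and let `m, m'` satisfy `(m, u) = (m', u') = 1`, `m ≡ m' (mod e)`.  Then the integers
`d` with `d ≡ c_d (mod Q)`, `u ∣ A d m + B`, `u' ∣ A d m' + B` form exactly one class `r` modulo
`N = Q u v = Q [u, u']`, and for every integer `h` the phase `e(r h/N)` factors (Chinese remainder
theorem) as `e(c_d h (uv)‾/Q) · e(−hB (AQv m)‾/u) · e(−hB (AQu m')‾/v)`: a unimodular factor not
depending on `m, m'`, a Kloosterman fraction in `m` to modulus `u`, and one in `m'` to modulus `v`.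
[cite: BombieriFriedlanderIwaniecActa1986, §6 (6.1), (6.10)] -/
theorem DK_congr_structure {A : ℕ} {B : ℤ} {Q u u' : ℕ} (hQ : 0 < Q)
    (hu : Squarefree u) (hu' : Squarefree u') (hAu : A.Coprime u) (hAu' : A.Coprime u')
    (hQu : Q.Coprime u) (hQu' : Q.Coprime u') (cd m m' : ℤ) (hm : Int.gcd m u = 1) (hm' : Int.gcd m' u' = 1)
    (hmm : m ≡ m' [ZMOD (Nat.gcd u u' : ℕ)]) :
    ∃ r : ZMod (Q * u * (u' / Nat.gcd u u')),
      (∀ d : ℤ, (d ≡ cd [ZMOD Q] ∧ (u : ℤ) ∣ (A : ℤ) * d * m + B ∧ (u' : ℤ) ∣ (A : ℤ) * d * m' + B) ↔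
          (d : ZMod (Q * u * (u' / Nat.gcd u u'))) = r) ∧
      ∀ h : ℤ, ((𝐞 ((r.val : ℝ) * h / ((Q * u * (u' / Nat.gcd u u') : ℕ) : ℝ)) : Circle) : ℂ) =
        Complex.exp (2 * Real.pi * Complex.I *
          ((((((cd * h : ℤ) : ZMod Q) *
              (((u * (u' / Nat.gcd u u') : ℕ) : ZMod Q))⁻¹).val : ℕ) : ℂ) / (Q : ℂ))) *
        Complex.exp (2 * Real.pi * Complex.I *
          (((-(h * B) : ℤ) : ℂ) *
            ((((((((A * Q * (u' / Nat.gcd u u') : ℕ) : ℤ) * m : ℤ) : ZMod u))⁻¹).val : ℕ) : ℂ) /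
              (u : ℂ))) *
        Complex.exp (2 * Real.pi * Complex.I *
          (((-(h * B) : ℤ) : ℂ) *
            ((((((((A * Q * u : ℕ) : ℤ) * m' : ℤ) : ZMod (u' / Nat.gcd u u')))⁻¹).val : ℕ) : ℂ) /
              ((u' / Nat.gcd u u' : ℕ) : ℂ))) := by
  classical
  obtain ⟨hu'e, hev, huv, he0, hv0, -, -⟩ := DK_gcd_facts hu hu'
  set e : ℕ := Nat.gcd u u' with he
  set v : ℕ := u' / e with hv
  have hu0 : 0 < u := Nat.pos_of_ne_zero hu.ne_zero
  haveI : NeZero Q := ⟨hQ.ne'⟩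
  haveI : NeZero u := ⟨hu0.ne'⟩
  haveI : NeZero v := ⟨hv0.ne'⟩
  haveI : NeZero (Q * u * v) := ⟨(Nat.mul_pos (Nat.mul_pos hQ hu0) hv0).ne'⟩
  have hvu' : v ∣ u' := ⟨e, by rw [mul_comm]; exact hu'e⟩
  have hQv : Q.Coprime v := Nat.Coprime.coprime_dvd_right hvu' hQu'
  have hAv : A.Coprime v := Nat.Coprime.coprime_dvd_right hvu' hAu'
  have hm'v : Int.gcd m' v = 1 := DK_int_gcd_eq_one_of_dvd hm' hvu'
  have heu : e ∣ u := Nat.gcd_dvd_left u u'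
  -- the units `A m (mod u)` and `A m' (mod v)`
  have hAm : IsUnit ((((A : ℤ) * m : ℤ)) : ZMod u) := by
    rw [← hooley_gcd_eq_one_iff_isUnit, ← Int.isCoprime_iff_gcd_eq_one]
    exact IsCoprime.mul_left (Nat.isCoprime_iff_coprime.mpr hAu)
      (Int.isCoprime_iff_gcd_eq_one.mpr hm)
  have hAm' : IsUnit ((((A : ℤ) * m' : ℤ)) : ZMod v) := by
    rw [← hooley_gcd_eq_one_iff_isUnit, ← Int.isCoprime_iff_gcd_eq_one]
    exact IsCoprime.mul_left (Nat.isCoprime_iff_coprime.mpr hAv)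
      (Int.isCoprime_iff_gcd_eq_one.mpr hm'v)
  have hQvU : IsUnit (((Q * v : ℕ)) : ZMod u) :=
    (ZMod.isUnit_iff_coprime _ _).mpr (Nat.Coprime.mul_left hQu huv.symm)
  have hQuU : IsUnit (((Q * u : ℕ)) : ZMod v) :=
    (ZMod.isUnit_iff_coprime _ _).mpr (Nat.Coprime.mul_left hQv huv)
  -- the residues
  set r₁ : ZMod u := -(B : ZMod u) * ((((A : ℤ) * m : ℤ)) : ZMod u)⁻¹ with hr₁
  set r₂ : ZMod v := -(B : ZMod v) * ((((A : ℤ) * m' : ℤ)) : ZMod v)⁻¹ with hr₂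
  have hiff₁ : ∀ d : ℤ, (u : ℤ) ∣ (A : ℤ) * d * m + B ↔ (d : ZMod u) = r₁ := by
    intro d
    rw [show (A : ℤ) * d * m + B = d * ((A : ℤ) * m) + B by ring]
    exact DK_dvd_iff_eq_residue hAm B d
  have hiff₂ : ∀ d : ℤ, (v : ℤ) ∣ (A : ℤ) * d * m' + B ↔ (d : ZMod v) = r₂ := by
    intro d
    rw [show (A : ℤ) * d * m' + B = d * ((A : ℤ) * m') + B by ring]
    exact DK_dvd_iff_eq_residue hAm' B d
  -- reduction to three coprime moduli
  have h3 : ∀ d : ℤ, (d ≡ cd [ZMOD Q] ∧ (u : ℤ) ∣ (A : ℤ) * d * m + B ∧ (u' : ℤ) ∣ (A : ℤ) * d * m' + B) ↔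
      ((d : ZMod Q) = (cd : ZMod Q) ∧ (d : ZMod u) = r₁ ∧ (d : ZMod v) = r₂) := by
    intro d
    rw [← hiff₁ d, ← hiff₂ d, ZMod.intCast_eq_intCast_iff]
    constructor
    · rintro ⟨h1, h2, h3⟩
      exact ⟨h1, h2, dvd_trans (Int.natCast_dvd_natCast.mpr hvu') h3⟩
    · rintro ⟨h1, h2, h3⟩
      refine ⟨h1, h2, ?_⟩
      have g1 : (e : ℤ) ∣ (A : ℤ) * d * m + B := dvd_trans (Int.natCast_dvd_natCast.mpr heu) h2
      have g2 : (e : ℤ) ∣ ((A : ℤ) * d * m' + B) - ((A : ℤ) * d * m + B) := by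
        rw [show ((A : ℤ) * d * m' + B) - ((A : ℤ) * d * m + B) = (A : ℤ) * d * (m' - m) by ring]
        exact Dvd.dvd.mul_left hmm.dvd _
      have g3 : (e : ℤ) ∣ (A : ℤ) * d * m' + B := by
        have := dvd_add g2 g1
        rwa [sub_add_cancel] at this
      rw [hu'e, Nat.cast_mul]
      exact IsCoprime.mul_dvd (Nat.isCoprime_iff_coprime.mpr hev) g3 h3
  obtain ⟨r, hr⟩ := DK_exists_residue_three hQ hu0 hv0 hQu hQv huv (cd : ZMod Q) r₁ r₂
  refine ⟨r, fun d => (h3 d).trans (hr d), fun h => ?_⟩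
  -- the phase
  set ρ : ℤ := ((r.val : ℕ) : ℤ) with hρ
  have hρr : (ρ : ZMod (Q * u * v)) = r := by
    rw [hρ, Int.cast_natCast, ZMod.natCast_zmod_val]
  obtain ⟨hρQ, hρu, hρv⟩ := (hr ρ).mpr hρr
  simp only [hρ, Int.cast_natCast] at hρQ hρu hρv
  rw [DK_fourierChar_eq_stdAddChar, DK_stdAddChar_split_three hQu hQv huv]
  congr 2
  · -- the `Q`-component
    rw [DK_stdAddChar_eq_exp_val]
    congr 5
    push_cast
    rw [hρQ]
  · -- the `u`-component: a Kloosterman fraction in `m`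
    rw [hooley_term_eq_stdAddChar]
    congr 1
    have key : (((((A * Q * v : ℕ) : ℤ) * m : ℤ)) : ZMod u)⁻¹ =
        ((((A : ℤ) * m : ℤ)) : ZMod u)⁻¹ * ((((Q * v : ℕ)) : ZMod u))⁻¹ := by
      rw [← Literature.NumberTheory.Sieve.Drappeau2017.zmod_mul_inv_of_isUnit hAm hQvU]
      congr 1
      push_cast
      ring
    rw [key]
    push_cast
    rw [hρu, hr₁]
    push_cast
    ring
  · -- the `v`-component: a Kloosterman fraction in `m'`
    rw [hooley_term_eq_stdAddChar]
    congr 1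
    have key : (((((A * Q * u : ℕ) : ℤ) * m' : ℤ)) : ZMod v)⁻¹ =
        ((((A : ℤ) * m' : ℤ)) : ZMod v)⁻¹ * ((((Q * u : ℕ)) : ZMod v))⁻¹ := by
      rw [← Literature.NumberTheory.Sieve.Drappeau2017.zmod_mul_inv_of_isUnit hAm' hQuU]
      congr 1
      push_cast
      ring
    rw [key]
    push_cast
    rw [hρv, hr₂]
    push_cast
    ring

/-! ### Splitting a sum over pairs `y ≡ y' (mod e)` into classes -/

/-- **Classes modulo `e`.**  For finite sets of integers `S, T` and `e ≥ 1`,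
`∑_{(y,y') ∈ S × T, y ≡ y' (e)} f(y) g(y') = ∑_{c mod e} (∑_{y ∈ S, y ≡ c} f(y)) (∑_{y' ∈ T, y' ≡ c} g(y'))`.
[folklore] -/
theorem DK_sum_pairs_modEq_eq {e : ℕ} (he : 0 < e) (S T : Finset ℤ) (f g : ℤ → ℂ) :
    ∑ p ∈ (S ×ˢ T).filter (fun p : ℤ × ℤ => p.1 ≡ p.2 [ZMOD e]), f p.1 * g p.2 =
      ∑ c ∈ Finset.range e, (∑ y ∈ S.filter (fun y : ℤ => y ≡ c [ZMOD e]), f y) *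
        (∑ y ∈ T.filter (fun y : ℤ => y ≡ c [ZMOD e]), g y) := by
  classical
  have he' : (0 : ℤ) < e := by exact_mod_cast he
  set F : Finset (ℤ × ℤ) := (S ×ˢ T).filter (fun p : ℤ × ℤ => p.1 ≡ p.2 [ZMOD e]) with hF
  set cl : ℤ × ℤ → ℕ := fun p => (p.1 % (e : ℤ)).toNat with hcl
  have hmaps : ∀ p ∈ F, cl p ∈ Finset.range e := by
    intro p _
    rw [Finset.mem_range]
    have h1 : 0 ≤ p.1 % (e : ℤ) := Int.emod_nonneg _ he'.ne'
    have h2 : p.1 % (e : ℤ) < e := Int.emod_lt_of_pos _ he'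
    simp only [hcl]
    omega
  rw [← Finset.sum_fiberwise_of_maps_to hmaps]
  refine Finset.sum_congr rfl fun c hc => ?_
  rw [Finset.mem_range] at hc
  have hiff : ∀ y : ℤ, (y % (e : ℤ)).toNat = c ↔ y ≡ (c : ℤ) [ZMOD e] := by
    intro y
    have h1 : 0 ≤ y % (e : ℤ) := Int.emod_nonneg _ he'.ne'
    rw [Int.ModEq, Int.emod_eq_of_lt (by positivity : (0 : ℤ) ≤ c)
      (by exact_mod_cast hc : (c : ℤ) < e)]
    omega
  have hfib : F.filter (fun p => cl p = c) =
      (S.filter (fun y : ℤ => y ≡ c [ZMOD e])) ×ˢ (T.filter (fun y : ℤ => y ≡ c [ZMOD e])) := by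
    ext p
    simp only [hF, hcl, Finset.mem_filter, Finset.mem_product, hiff]
    constructor
    · rintro ⟨⟨⟨h1, h2⟩, h3⟩, h4⟩
      exact ⟨⟨h1, h4⟩, h2, h3.symm.trans h4⟩
    · rintro ⟨⟨h1, h4⟩, h2, h5⟩
      exact ⟨⟨⟨h1, h2⟩, h4.trans h5.symm⟩, h4⟩
  rw [hfib, Finset.sum_product, Finset.sum_mul_sum]

/-! ### The two class sums: incomplete Kloosterman sums in progressions -/

/-- Multiplying by an integer coprime to `s` does not change coprimality with `s`. [folklore] -/
theorem DK_gcd_mul_eq_one_iff {k : ℕ} {s : ℕ} (hk : k.Coprime s) (x : ℤ) :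
    Int.gcd ((k : ℤ) * x) s = 1 ↔ Int.gcd x s = 1 := by
  rw [← Int.isCoprime_iff_gcd_eq_one, ← Int.isCoprime_iff_gcd_eq_one, IsCoprime.mul_left_iff]
  exact ⟨fun h => h.2, fun h => ⟨Nat.isCoprime_iff_coprime.mpr hk, h⟩⟩

/-- `(−hB, s) = (h, s)` when `(B, s) = 1`. [folklore] -/
theorem DK_gcd_neg_mul_eq {h B : ℤ} {s : ℕ} (hB : Int.gcd B s = 1) :
    Int.gcd (-(h * B)) s = Int.gcd h s := by
  rw [Int.neg_gcd, Int.gcd, Int.gcd, Int.natAbs_mul, Int.natAbs_natCast]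
  have hB' : Nat.Coprime B.natAbs s := by
    rw [Int.gcd, Int.natAbs_natCast] at hB
    exact hB
  exact Nat.Coprime.gcd_mul_right_cancel _ hB'

/-- **The class sum to modulus `u`.**  Let `u = e u₁` with `(e, u₁) = 1`, `k` coprime to `u`,
`(Q, u₁) = 1`.  For a class `ρ (mod e)` and `y₁ ≤ y₂`,
`‖∑_{y₁<y≤y₂, (c_m+Qy, u)=1, y≡ρ (e)} e(a (k(c_m+Qy))‾/u)‖ ≤ ((y₂−y₁)/e + 2)/u₁ · (a,u₁) + τ(u₁) √u₁ √(a,u₁) (1 + log u₁)`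
(the tree's `KI_sum_subprogression_le`: along the class the residue modulo `e` is constant and
Weil's bound is applied modulo `u₁`).  [cite: BettinChandee2018, Appendix Lemma 1] -/
theorem DK_classSum_left_le {u e u₁ k Q : ℕ} (hue : u = e * u₁) (he : 0 < e) (hu₁ : 0 < u₁)
    (heu₁ : e.Coprime u₁) (hku : k.Coprime u) (hQu₁ : Q.Coprime u₁) (a cm ρ y₁ y₂ : ℤ)
    (hy : y₁ ≤ y₂) :
    ‖∑ y ∈ (Finset.Ioc y₁ y₂).filter (fun y : ℤ => Int.gcd (cm + Q * y) u = 1 ∧ y ≡ ρ [ZMOD e]),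
        Complex.exp (2 * Real.pi * Complex.I *
          ((a : ℂ) * ((((((k : ℤ) * (cm + Q * y) : ℤ) : ZMod u)⁻¹).val : ℕ) : ℂ) / (u : ℂ)))‖ ≤
      (((y₂ - y₁ : ℤ) : ℝ) / e + 2) / u₁ * Int.gcd a u₁ +
        (Nat.divisors u₁).card * Real.sqrt u₁ * Real.sqrt (Int.gcd a u₁) * (1 + Real.log u₁) := by
  have hku₁ : k.Coprime u₁ := Nat.Coprime.coprime_dvd_right ⟨e, by rw [hue, mul_comm]⟩ hku
  have hqm : (k * Q * e).Coprime u₁ := Nat.Coprime.mul_left (Nat.Coprime.mul_left hku₁ hQu₁) heu₁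
  have hdiv : e ∣ k * Q * e := dvd_mul_left e _
  have key := KI_sum_subprogression_le (a := a) (v := (k : ℤ) * cm) (y₁ := y₁) (y₂ := y₂) (ρ := ρ)
    hue he hu₁ heu₁ he hqm hdiv Nat.one_pos (Nat.coprime_one_left _) hy
  have hlin : ∀ y : ℤ, (k : ℤ) * cm + ((k * Q : ℕ) : ℤ) * y = (k : ℤ) * (cm + Q * y) := by
    intro y; push_cast; ring
  have hfilt : (Finset.Ioc y₁ y₂).filter (fun y : ℤ =>
        (Int.gcd ((k : ℤ) * cm + ((k * Q : ℕ) : ℤ) * y) u = 1 ∧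
          Int.gcd ((k : ℤ) * cm + ((k * Q : ℕ) : ℤ) * y) (1 : ℕ) = 1) ∧ y ≡ ρ [ZMOD e]) =
      (Finset.Ioc y₁ y₂).filter (fun y : ℤ => Int.gcd (cm + Q * y) u = 1 ∧ y ≡ ρ [ZMOD e]) := by
    refine Finset.filter_congr fun y _ => ?_
    rw [hlin y, DK_gcd_mul_eq_one_iff hku]
    simp
  rw [hfilt] at key
  simp only [hlin, Nat.divisors_one, Finset.card_singleton, Nat.cast_one, one_mul] at key
  exact key

/-- **The class sum to modulus `v`.**  Let `u' = e v` with `(e, v) = 1`, `k, Q` coprime to `v`,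
and let `ρ (mod e)` be a class with `(c_m + Qρ, e) = 1`.  For `y₁ ≤ y₂`,
`‖∑_{y₁<y≤y₂, (c_m+Qy, u')=1, y≡ρ (e)} e(a (k(c_m+Qy))‾/v)‖ ≤ ((y₂−y₁)/e + 2)/v · (a,v) + τ(v) √v √(a,v) (1 + log v)`
(on the class, `(c_m + Qy, e) = 1` automatically, so the condition is `(c_m+Qy, v) = 1` and the
tree's `KI_sum_subprogression_le` applies with the trivial factorisation `v = 1 · v`).
[cite: BettinChandee2018, Appendix Lemma 1] -/
theorem DK_classSum_right_le {u' e v k Q : ℕ} (hu'e : u' = e * v) (he : 0 < e) (hv : 0 < v)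
    (hev : e.Coprime v) (hkv : k.Coprime v) (hQv : Q.Coprime v) (a cm ρ y₁ y₂ : ℤ)
    (hy : y₁ ≤ y₂) (hρ : Int.gcd (cm + Q * ρ) e = 1) :
    ‖∑ y ∈ (Finset.Ioc y₁ y₂).filter (fun y : ℤ => Int.gcd (cm + Q * y) u' = 1 ∧ y ≡ ρ [ZMOD e]),
        Complex.exp (2 * Real.pi * Complex.I *
          ((a : ℂ) * ((((((k : ℤ) * (cm + Q * y) : ℤ) : ZMod v)⁻¹).val : ℕ) : ℂ) / (v : ℂ)))‖ ≤
      (((y₂ - y₁ : ℤ) : ℝ) / e + 2) / v * Int.gcd a v +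
        (Nat.divisors v).card * Real.sqrt v * Real.sqrt (Int.gcd a v) * (1 + Real.log v) := by
  have hqm : (k * Q * e).Coprime v := Nat.Coprime.mul_left (Nat.Coprime.mul_left hkv hQv) hev
  have hdiv : 1 ∣ k * Q * e := one_dvd _
  have key := KI_sum_subprogression_le (a := a) (v := (k : ℤ) * cm) (y₁ := y₁) (y₂ := y₂) (ρ := ρ)
    (show v = 1 * v by rw [one_mul]) Nat.one_pos hv (Nat.coprime_one_left _) he hqm hdiv
    Nat.one_pos (Nat.coprime_one_left _) hy
  have hlin : ∀ y : ℤ, (k : ℤ) * cm + ((k * Q : ℕ) : ℤ) * y = (k : ℤ) * (cm + Q * y) := by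
    intro y; push_cast; ring
  -- on the class `y ≡ ρ (mod e)`, `(c_m + Qy, e) = 1`
  have hclass : ∀ y : ℤ, y ≡ ρ [ZMOD e] → Int.gcd (cm + Q * y) e = 1 := by
    intro y hye
    have h1 : cm + Q * y ≡ cm + Q * ρ [ZMOD e] := Int.ModEq.add_left _ (Int.ModEq.mul_left _ hye)
    rw [← Int.gcd_emod, h1, Int.gcd_emod, hρ]
  have hfilt : (Finset.Ioc y₁ y₂).filter (fun y : ℤ =>
        (Int.gcd ((k : ℤ) * cm + ((k * Q : ℕ) : ℤ) * y) v = 1 ∧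
          Int.gcd ((k : ℤ) * cm + ((k * Q : ℕ) : ℤ) * y) (1 : ℕ) = 1) ∧ y ≡ ρ [ZMOD e]) =
      (Finset.Ioc y₁ y₂).filter (fun y : ℤ => Int.gcd (cm + Q * y) u' = 1 ∧ y ≡ ρ [ZMOD e]) := by
    refine Finset.filter_congr fun y _ => ?_
    rw [hlin y, DK_gcd_mul_eq_one_iff hkv]
    simp only [Nat.cast_one, Int.gcd_one_right, and_true]
    constructor
    · rintro ⟨h1, h2⟩
      refine ⟨?_, h2⟩
      rw [hu'e, Nat.cast_mul, ← Int.isCoprime_iff_gcd_eq_one]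
      exact IsCoprime.mul_right (Int.isCoprime_iff_gcd_eq_one.mpr (hclass y h2))
        (Int.isCoprime_iff_gcd_eq_one.mpr h1)
    · rintro ⟨h1, h2⟩
      exact ⟨DK_int_gcd_eq_one_of_dvd h1 ⟨e, by rw [hu'e, mul_comm]⟩, h2⟩
  rw [hfilt] at key
  simp only [hlin, Nat.divisors_one, Finset.card_singleton, Nat.cast_one, one_mul] at key
  exact key


/-! ### The sum over compatible pairs -/

/-- `√g ≤ g` for a natural number `g ≥ 1`; hence `X g + W √g ≤ g (X + W)` for `W ≥ 0`.
[folklore] -/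
theorem DK_lin_sqrt_le (X : ℝ) {W : ℝ} (hW : 0 ≤ W) {g : ℕ} (hg : 1 ≤ g) :
    X * g + W * Real.sqrt g ≤ g * (X + W) := by
  have hg1 : (1 : ℝ) ≤ g := by exact_mod_cast hg
  have hsq : Real.sqrt g ≤ g := by
    rw [Real.sqrt_le_iff]
    exact ⟨by linarith, by nlinarith⟩
  nlinarith

/-- **The sum of the factored phases over the compatible pairs** (BFI §§8–9 in the present
setting).  For squarefree `u, u'` coprime to `A Q` and to `B`, `e = (u,u')`, `u₁ = u/e`,
`v = u'/e`, an integer `h` and `y₁ ≤ y₂`, writing `m = c_m + Qy`, `m' = c_m + Qy'`: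
`‖∑_{(y,y'), (m,u)=(m',u')=1, m≡m' (e)} e(−hB (AQv m)‾/u) e(−hB (AQu m')‾/v)‖`
`≤ e · (h, u₁v) · ( ((y₂−y₁)/e+2)/u₁ + τ(u₁)√u₁ (1+log u₁) ) · ( ((y₂−y₁)/e+2)/v + τ(v)√v (1+log v) )`
(split into the `e` classes `y ≡ y' ≡ c (mod e)`; in each class the double sum factors and the two
factors are incomplete Kloosterman sums in progressions, bounded by Weil's bound; the classes with
`(c_m + Qc, e) > 1` are empty). [cite: BombieriFriedlanderIwaniecActa1986, §9 (9.1)–(9.3)] -/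
theorem DK_pairSum_le {A : ℕ} {B : ℤ} {Q u u' : ℕ} (hu : Squarefree u) (hu' : Squarefree u')
    (hAu : A.Coprime u) (hAu' : A.Coprime u') (hBu : Int.gcd B u = 1) (hBu' : Int.gcd B u' = 1)
    (hQu : Q.Coprime u) (hQu' : Q.Coprime u') (cm h y₁ y₂ : ℤ) (hy : y₁ ≤ y₂) :
    ‖∑ p ∈ ((Finset.Ioc y₁ y₂) ×ˢ (Finset.Ioc y₁ y₂)).filter (fun p : ℤ × ℤ =>
        Int.gcd (cm + Q * p.1) u = 1 ∧ Int.gcd (cm + Q * p.2) u' = 1 ∧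
          cm + Q * p.1 ≡ cm + Q * p.2 [ZMOD (Nat.gcd u u' : ℕ)]),
        (Complex.exp (2 * Real.pi * Complex.I *
          (((-(h * B) : ℤ) : ℂ) *
            (((((((A * Q * (u' / Nat.gcd u u') : ℕ) : ℤ) * (cm + Q * p.1) : ℤ) :
              ZMod u)⁻¹).val : ℕ) : ℂ) / (u : ℂ))) *
        Complex.exp (2 * Real.pi * Complex.I *
          (((-(h * B) : ℤ) : ℂ) *
            (((((((A * Q * u : ℕ) : ℤ) * (cm + Q * p.2) : ℤ) :
              ZMod (u' / Nat.gcd u u'))⁻¹).val : ℕ) : ℂ) / ((u' / Nat.gcd u u' : ℕ) : ℂ))))‖ ≤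
      (Nat.gcd u u' : ℝ) * (Int.gcd h ((u / Nat.gcd u u') * (u' / Nat.gcd u u') : ℕ) : ℕ) *
        ((((y₂ - y₁ : ℤ) : ℝ) / (Nat.gcd u u' : ℕ) + 2) / ((u / Nat.gcd u u' : ℕ) : ℝ) +
          (Nat.divisors (u / Nat.gcd u u')).card * Real.sqrt ((u / Nat.gcd u u' : ℕ) : ℝ) *
            (1 + Real.log ((u / Nat.gcd u u' : ℕ) : ℝ))) *
        ((((y₂ - y₁ : ℤ) : ℝ) / (Nat.gcd u u' : ℕ) + 2) / ((u' / Nat.gcd u u' : ℕ) : ℝ) +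
          (Nat.divisors (u' / Nat.gcd u u')).card * Real.sqrt ((u' / Nat.gcd u u' : ℕ) : ℝ) *
            (1 + Real.log ((u' / Nat.gcd u u' : ℕ) : ℝ))) := by
  classical
  obtain ⟨hu'e, hev, huv, he0, hv0, hue, heu₁⟩ := DK_gcd_facts hu hu'
  set e : ℕ := Nat.gcd u u' with he
  set v : ℕ := u' / e with hv
  set u₁ : ℕ := u / e with hu₁
  have hu0 : 0 < u := Nat.pos_of_ne_zero hu.ne_zero
  have hu₁0 : 0 < u₁ := Nat.div_pos (Nat.le_of_dvd hu0 (Nat.gcd_dvd_left u u')) he0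
  have heu : e ∣ u := Nat.gcd_dvd_left u u'
  have hvu' : v ∣ u' := ⟨e, by rw [mul_comm]; exact hu'e⟩
  have hu₁u : u₁ ∣ u := ⟨e, by rw [mul_comm]; exact hue⟩
  have hu₁v : u₁.Coprime v := Nat.coprime_div_gcd_div_gcd he0
  have hQe : Q.Coprime e := Nat.Coprime.coprime_dvd_right heu hQu
  have hQv : Q.Coprime v := Nat.Coprime.coprime_dvd_right hvu' hQu'
  have hQu₁ : Q.Coprime u₁ := Nat.Coprime.coprime_dvd_right hu₁u hQu
  have hAv : A.Coprime v := Nat.Coprime.coprime_dvd_right hvu' hAu'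
  have hBu₁ : Int.gcd B u₁ = 1 := DK_int_gcd_eq_one_of_dvd hBu hu₁u
  have hBv : Int.gcd B v = 1 := DK_int_gcd_eq_one_of_dvd hBu' hvu'
  have hk₁ : (A * Q * v).Coprime u :=
    Nat.Coprime.mul_left (Nat.Coprime.mul_left hAu hQu) huv.symm
  have hk₂ : (A * Q * u).Coprime v :=
    Nat.Coprime.mul_left (Nat.Coprime.mul_left hAv hQv) huv
  -- notation for the phases and the bounds
  set Φ₁ : ℤ → ℂ := fun y => Complex.exp (2 * Real.pi * Complex.I *
      (((-(h * B) : ℤ) : ℂ) *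
        (((((((A * Q * v : ℕ) : ℤ) * (cm + Q * y) : ℤ) : ZMod u)⁻¹).val : ℕ) : ℂ) / (u : ℂ)))
    with hΦ₁
  set Φ₂ : ℤ → ℂ := fun y => Complex.exp (2 * Real.pi * Complex.I *
      (((-(h * B) : ℤ) : ℂ) *
        (((((((A * Q * u : ℕ) : ℤ) * (cm + Q * y) : ℤ) : ZMod v)⁻¹).val : ℕ) : ℂ) / (v : ℂ)))
    with hΦ₂
  set X₁ : ℝ := (((y₂ - y₁ : ℤ) : ℝ) / (e : ℕ) + 2) / ((u₁ : ℕ) : ℝ) with hX₁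
  set X₂ : ℝ := (((y₂ - y₁ : ℤ) : ℝ) / (e : ℕ) + 2) / ((v : ℕ) : ℝ) with hX₂
  set W₁ : ℝ := (Nat.divisors u₁).card * Real.sqrt ((u₁ : ℕ) : ℝ) * (1 + Real.log ((u₁ : ℕ) : ℝ))
    with hW₁
  set W₂ : ℝ := (Nat.divisors v).card * Real.sqrt ((v : ℕ) : ℝ) * (1 + Real.log ((v : ℕ) : ℝ))
    with hW₂
  have hy0 : (0 : ℝ) ≤ ((y₂ - y₁ : ℤ) : ℝ) := by exact_mod_cast (sub_nonneg.mpr hy)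
  have hlog₁ : 0 ≤ 1 + Real.log ((u₁ : ℕ) : ℝ) := by
    have := Real.log_nonneg (show (1 : ℝ) ≤ ((u₁ : ℕ) : ℝ) by exact_mod_cast hu₁0); linarith
  have hlog₂ : 0 ≤ 1 + Real.log ((v : ℕ) : ℝ) := by
    have := Real.log_nonneg (show (1 : ℝ) ≤ ((v : ℕ) : ℝ) by exact_mod_cast hv0); linarith
  have hnum : 0 ≤ ((y₂ - y₁ : ℤ) : ℝ) / (e : ℕ) + 2 := by
    have := div_nonneg hy0 (Nat.cast_nonneg e); linarith
  have hX₁0 : 0 ≤ X₁ := by rw [hX₁]; exact div_nonneg hnum (Nat.cast_nonneg _)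
  have hX₂0 : 0 ≤ X₂ := by rw [hX₂]; exact div_nonneg hnum (Nat.cast_nonneg _)
  have hW₁0 : 0 ≤ W₁ := by
    rw [hW₁]; exact mul_nonneg (mul_nonneg (Nat.cast_nonneg _) (Real.sqrt_nonneg _)) hlog₁
  have hW₂0 : 0 ≤ W₂ := by
    rw [hW₂]; exact mul_nonneg (mul_nonneg (Nat.cast_nonneg _) (Real.sqrt_nonneg _)) hlog₂
  have hP0 : 0 ≤ (X₁ + W₁) * (X₂ + W₂) := mul_nonneg (add_nonneg hX₁0 hW₁0) (add_nonneg hX₂0 hW₂0)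
  -- the gcd's `(−hB, u₁) = (h, u₁)`, `(−hB, v) = (h, v)`, `(h,u₁)(h,v) = (h, u₁v)`
  set γ₁ : ℕ := Int.gcd h u₁ with hγ₁
  set γ₂ : ℕ := Int.gcd h v with hγ₂
  have hg₁ : Int.gcd (-(h * B)) u₁ = γ₁ := DK_gcd_neg_mul_eq hBu₁
  have hg₂ : Int.gcd (-(h * B)) v = γ₂ := DK_gcd_neg_mul_eq hBv
  have hγ₁1 : 1 ≤ γ₁ := Int.gcd_pos_of_ne_zero_right _ (by exact_mod_cast hu₁0.ne')
  have hγ₂1 : 1 ≤ γ₂ := Int.gcd_pos_of_ne_zero_right _ (by exact_mod_cast hv0.ne')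
  have hγ : (Int.gcd h ((u₁ * v : ℕ)) : ℕ) = γ₁ * γ₂ := by
    rw [hγ₁, hγ₂, Int.gcd, Int.gcd, Int.gcd, Int.natAbs_natCast, Int.natAbs_natCast,
      Int.natAbs_natCast]
    exact Nat.Coprime.gcd_mul _ hu₁v
  -- Step 1: the compatibility condition in terms of `y, y'`
  have hmod : ∀ y y' : ℤ, cm + Q * y ≡ cm + Q * y' [ZMOD e] ↔ y ≡ y' [ZMOD e] := by
    intro y y'
    constructor
    · intro hc
      have h1 : (Q : ℤ) * y ≡ Q * y' [ZMOD e] := Int.ModEq.add_left_cancel' cm hc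
      have h2 : (e : ℤ) ∣ (y' - y) * Q := by
        rw [show (y' - y) * (Q : ℤ) = Q * y' - Q * y by ring]; exact h1.dvd
      exact Int.modEq_iff_dvd.mpr
        (IsCoprime.dvd_of_dvd_mul_right (Nat.isCoprime_iff_coprime.mpr hQe.symm) h2)
    · intro hc
      exact Int.ModEq.add_left _ (Int.ModEq.mul_left _ hc)
  have hfilt : ((Finset.Ioc y₁ y₂) ×ˢ (Finset.Ioc y₁ y₂)).filter (fun p : ℤ × ℤ =>
        Int.gcd (cm + Q * p.1) u = 1 ∧ Int.gcd (cm + Q * p.2) u' = 1 ∧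
          cm + Q * p.1 ≡ cm + Q * p.2 [ZMOD e]) =
      (((Finset.Ioc y₁ y₂).filter (fun y : ℤ => Int.gcd (cm + Q * y) u = 1)) ×ˢ
        ((Finset.Ioc y₁ y₂).filter (fun y : ℤ => Int.gcd (cm + Q * y) u' = 1))).filter
        (fun p : ℤ × ℤ => p.1 ≡ p.2 [ZMOD e]) := by
    ext p
    simp only [Finset.mem_filter, Finset.mem_product, hmod]
    tauto
  show ‖∑ p ∈ ((Finset.Ioc y₁ y₂) ×ˢ (Finset.Ioc y₁ y₂)).filter _, Φ₁ p.1 * Φ₂ p.2‖ ≤ _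
  rw [hfilt, DK_sum_pairs_modEq_eq he0]
  -- Step 2: each class
  have hcls : ∀ c ∈ Finset.range e,
      ‖(∑ y ∈ ((Finset.Ioc y₁ y₂).filter (fun y : ℤ => Int.gcd (cm + Q * y) u = 1)).filter
            (fun y : ℤ => y ≡ (c : ℤ) [ZMOD e]), Φ₁ y) *
        (∑ y ∈ ((Finset.Ioc y₁ y₂).filter (fun y : ℤ => Int.gcd (cm + Q * y) u' = 1)).filter
            (fun y : ℤ => y ≡ (c : ℤ) [ZMOD e]), Φ₂ y)‖ ≤
        ((γ₁ * γ₂ : ℕ) : ℝ) * ((X₁ + W₁) * (X₂ + W₂)) := by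
    intro c _
    rw [Finset.filter_filter, Finset.filter_filter, norm_mul]
    by_cases hρ : Int.gcd (cm + Q * c) e = 1
    · have b₁ := DK_classSum_left_le hue he0 hu₁0 heu₁ hk₁ hQu₁ (-(h * B)) cm c y₁ y₂ hy
      have b₂ := DK_classSum_right_le hu'e he0 hv0 hev hk₂ hQv (-(h * B)) cm c y₁ y₂ hy hρ
      rw [hg₁] at b₁
      rw [hg₂] at b₂
      have b₁' : ‖∑ y ∈ (Finset.Ioc y₁ y₂).filter
            (fun y : ℤ => Int.gcd (cm + Q * y) u = 1 ∧ y ≡ (c : ℤ) [ZMOD e]), Φ₁ y‖ ≤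
          γ₁ * (X₁ + W₁) := by
        refine b₁.trans ?_
        have := DK_lin_sqrt_le X₁ hW₁0 hγ₁1
        rw [hX₁, hW₁] at this ⊢
        nlinarith [this]
      have b₂' : ‖∑ y ∈ (Finset.Ioc y₁ y₂).filter
            (fun y : ℤ => Int.gcd (cm + Q * y) u' = 1 ∧ y ≡ (c : ℤ) [ZMOD e]), Φ₂ y‖ ≤
          γ₂ * (X₂ + W₂) := by
        refine b₂.trans ?_
        have := DK_lin_sqrt_le X₂ hW₂0 hγ₂1
        rw [hX₂, hW₂] at this ⊢
        nlinarith [this]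
      calc _ ≤ (γ₁ * (X₁ + W₁)) * (γ₂ * (X₂ + W₂)) :=
            mul_le_mul b₁' b₂' (norm_nonneg _) (mul_nonneg (Nat.cast_nonneg _) (add_nonneg hX₁0 hW₁0))
        _ = ((γ₁ * γ₂ : ℕ) : ℝ) * ((X₁ + W₁) * (X₂ + W₂)) := by push_cast; ring
    · -- the first class sum is empty
      have hempty : (Finset.Ioc y₁ y₂).filter
          (fun y : ℤ => Int.gcd (cm + Q * y) u = 1 ∧ y ≡ (c : ℤ) [ZMOD e]) = ∅ := by
        refine Finset.filter_false_of_mem fun y _ => ?_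
        rintro ⟨h1, h2⟩
        apply hρ
        have h3 : Int.gcd (cm + Q * y) e = 1 := DK_int_gcd_eq_one_of_dvd h1 heu
        have h4 : cm + Q * y ≡ cm + Q * c [ZMOD e] := (hmod y c).mpr h2
        rw [← Int.gcd_emod, ← h4, Int.gcd_emod, h3]
      rw [hempty, Finset.sum_empty, norm_zero, zero_mul]
      exact mul_nonneg (Nat.cast_nonneg _) hP0
  -- Step 3: add up the `e` classes
  calc _ ≤ ∑ c ∈ Finset.range e, ‖(∑ y ∈ ((Finset.Ioc y₁ y₂).filter
              (fun y : ℤ => Int.gcd (cm + Q * y) u = 1)).filter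
              (fun y : ℤ => y ≡ (c : ℤ) [ZMOD e]), Φ₁ y) *
          (∑ y ∈ ((Finset.Ioc y₁ y₂).filter (fun y : ℤ => Int.gcd (cm + Q * y) u' = 1)).filter
              (fun y : ℤ => y ≡ (c : ℤ) [ZMOD e]), Φ₂ y)‖ := norm_sum_le _ _
    _ ≤ ∑ c ∈ Finset.range e, ((γ₁ * γ₂ : ℕ) : ℝ) * ((X₁ + W₁) * (X₂ + W₂)) :=
        Finset.sum_le_sum hcls
    _ = (e : ℝ) * (((γ₁ * γ₂ : ℕ) : ℝ) * ((X₁ + W₁) * (X₂ + W₂))) := by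
        rw [Finset.sum_const, Finset.card_range, nsmul_eq_mul]
    _ = _ := by rw [hγ, hX₁, hW₁, hX₂, hW₂]; ring

end Literature.NumberTheory.LFunctions

end
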